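import Summits.QuantumFields.BalabanUV.Beta.GAN24.ClassWeightSlotTransport
import Summits.QuantumFields.BalabanUV.Beta.GAN24.ExitFaceCurrentSectorSplit
import Summits.QuantumFields.BalabanUV.Beta.GAN24.SymCorrectorClassCurrent

/-!
# `BalabanUV.Beta.GAN24.TransportedDivFree` — binder row G-an2-4 ∕ (CONV-C), TRANSFER-III, the (III′) (C)-campaign's supplier `hB0` AT LEVELS `≥ 1`, **T-INV** (leaf-01 g86
# «LOCATED» L-leaf01-g86-1, CLOSED): **FIRST-LEG DIVERGENCE-FREENESS OF ALL CLASS-WEIGHTED TWO-LEG CURRENTS PASSES FROM A LOCAL TABLE FAMILY `S` TO ITS TRANSPORT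
# `𝒯S := κ u ↦ Ψ̂_Sᵀ ∘ slotPsiS r n S κ u ∘ Ψ̂_S`** (`Ψ̂_S = psiKS r n`, any `0 < n`, `r ∈ box`) — the hypothesis `hyp` of leaf-04's (D)-tower step
# `ExitFaceCurrentTowerStep.divFree_e3OfK_of_divFree` for `S` (slot direction `ν`, leg direction `β`, ALL class data) implies the SAME `hyp` for `𝒯S`, verbatim shape.
# (G-an2-4 CRUX TEAM (2), leaf prover `b2b-balaban-gan24-formalise-leaf-01`, gen 87; journal [LEAF01-G87-INTENT-1])

THE MECHANISM ([folklore]).  All three legs of `𝒯` are slot transports of scalar bond families: the slot by definition (`slotPsiS_apply_kernel`), the right corrector leg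
`X ∘ Ψ̂_S` of the ROW family and the left corrector leg `Ψ̂_Sᵀ ∘ X` of the COLUMN family (d1-leaf-03 TT3b `SymCorrectorSlot.comp_psiKS_inl_right ∕ comp_trK_psiKS_inl_left`, finite sums,
no hypothesis).  A class-weighted sum through a slot transport is the class-REWEIGHTED sum of the same direction (`ClassWeightSlotTransport.exists_classPot_slotPsiS`, one new potential
for all families), and slot transports in the passive legs commute with the convergent slot ∕ leg series (`SymCorrectorZeroMode.tsum_slotPsiS_param` — `slotPsiS` is a FINITE
combination with family-independent coefficients).  So the class current of `𝒯S` with data `(ρ, σ)` IS `slotPsiS r n` OF THE CLASS CURRENT OF `S` WITH THE REWEIGHTED DATA `(ρ′, σ′)`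
(§2 `current_transport_eq_slotPsiS`), the latter is first-leg divergence-free by `hyp`, and a divergence-free bond family has no face family (TT7
`SymCorrectorFaceDiv.slotPsiS_eq_self_of_div_eq_zero`): the transported current EQUALS the reweighted untransported one (§3), hence is divergence-free.  No Ward letter of `S` is used.

NOT IN PRINT; OUR BOOKKEEPING ([folklore] `tsum` bookkeeping BY NAME over `ClassWeightSlotTransport` (this gen), d1-leaf-03's `SymCorrectorFace ∕ SymCorrectorFaceDiv ∕ SymCorrectorSlot`,
leaf-01 g84's `SymCorrectorZeroMode` (`tsum_slotPsiS_param`, `summable_slotPsiS`), leaf-04's `ExitFaceCurrentSectorSplit` (`summable_slot_locStencil`, `summable_leg_slot_locStencil`);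
generic `d`, `0 < n`, `r ∈ box (d+1) n`, ANY local stencil family `S`; 0 `def`, 0 cited fact, 0 `def … : Prop`, 0 sorry).
HONEST FRAMING (cell contract, verbatim): «discharging `BetaPertH` makes Bałaban's UV stability UNCONDITIONAL — a real constructive-QFT result; it is NOT the continuum limit and NOT
the Clay problem.»  HONEST DEPENDENCY (verbatim): «continuum YM on T⁴ ⇐ BetaPertH ∧ nine spine estimates (0/9 proved); BetaPertH ⇐ (D1) ∧ (D4) ∧ CAP+tail; G-an2-4 gates asym, D1
and NE2/3/4.»

## What is proved
* §1 bookkeeping (scalars enter the slot transport by leaf-01 g84's `SymCorrectorClassCurrent.mul_slotPsiS`): `summable_slotPsiS_param` (a slot transport of a pointwise-summable parametrised family is summable in the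
  parameter), `transport_entry_eq` (the ff entry of `𝒯S ν u` at legs `(v, q)` as THREE nested scalar slot transports of `(κ,t,κ₁,y,κ₂,w) ↦ S κ t y w (inl κ₁)(inl κ₂)`).
* §2 `tsum_slot_transport_eq` (the slot step) and **`current_transport_eq_slotPsiS`**: for bounded data `ρ σ` and their slot-transport reweightings `ρ′ σ′` (hypotheses `hρ′ hσ′` = the identities of
  `ClassWeightSlotTransport`), `Σ'_q ρ(q_β)·Σ'_u σ(u_ν)·(𝒯S) ν u v q (inl κ′)(inl β) = slotPsiS r n (κ₁ y ↦ Σ'_q ρ′(q_β)·Σ'_u σ′(u_ν)·S ν u y q (inl κ₁)(inl β)) κ′ v`.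
* §3 **`divFree_transport_of_divFree`** — T-INV in the `hyp` currency of `ExitFaceCurrentTowerStep.divFree_e3OfK_of_divFree`.
WHAT THIS IS NOT: no statement about any particular table (the comb instance is the next file); NOT (Z); NOT `hB0`; NEVER «G-an2-4 closed» as (CONV-C); NOT D1, NOT `BetaPertH`,
NOT continuum, NOT Clay.  2026-08-27; no existing file touched.
-/

noncomputable section

open Finset
open scoped BigOperators
open Literature.MathematicalPhysics.QuantumFieldTheory
open Literature.MathematicalPhysics.QuantumFieldTheory.Balaban1983to89
open Literature.MathematicalPhysics.QuantumFieldTheory.Balaban1983to89.Beta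
open ExpKernelCalculus (Site MKer comp)
open OneStepResolventKernel (Fib LocStencil)
open AffineAveraging (Form1 box toSite unitVec)
open AveragingContours (blk)
open Summit.QuantumFields.BalabanUV.Beta.TameKernelCalculus (trK)
open Summit.QuantumFields.BalabanUV.Beta.KernelWardRelative (gaugeWt)
open Summit.QuantumFields.BalabanUV.Beta.SymCorrectorKernel (psiKS)
open Summit.QuantumFields.BalabanUV.Beta.SymCorrectorFace (faceWt faceWtSum b6unitVec_eq bondNbhd faceSum slotPsiS slotPsiS_apply_kernel)
open Summit.QuantumFields.BalabanUV.Beta.SymCorrectorFaceDiv (slotPsiS_eq_self_of_div_eq_zero)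
open Summit.QuantumFields.BalabanUV.Beta.SymCorrectorSlot (comp_psiKS_inl_right comp_trK_psiKS_inl_left)
open Summit.QuantumFields.BalabanUV.Beta.GAN24.SymCorrectorZeroMode (tsum_slotPsiS_param summable_slotPsiS slotPsiS_eq_add_mul_sum_sigma)
open Summit.QuantumFields.BalabanUV.Beta.GAN24.SlotTransportPeriodicWeight (summable_weight_mul)
open Summit.QuantumFields.BalabanUV.Beta.GAN24.ExitFaceCurrentSectorSplit (summable_slot_locStencil summable_leg_slot_locStencil)
open Summit.QuantumFields.BalabanUV.Beta.GAN24.ClassWeightSlotTransport (exists_classPot_slotPsiS exists_classPot_slotPsiS_kernel)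
open Summit.QuantumFields.BalabanUV.Beta.GAN24.SymCorrectorClassCurrent (mul_slotPsiS)

namespace Summit.QuantumFields.BalabanUV.Beta.GAN24.TransportedDivFree

variable {d : ℕ} {n : ℕ} (hn : 0 < n) {r : Fin (d + 1) → ℕ} (hr : r ∈ box (d + 1) n)

/-! ## §1 Bookkeeping: scalars, parametrised summability, the transported entry as three nested slot transports -/

/-- [folklore] **A SLOT TRANSPORT OF A POINTWISE-SUMMABLE PARAMETRISED FAMILY IS SUMMABLE IN THE PARAMETER** (it is a finite combination with family-independent coefficients). -/
theorem summable_slotPsiS_param {ι : Type*} {F : ι → Form1 (d + 1) ℝ} (hF : ∀ κ u, Summable fun i => F i κ u) (α : Fin (d + 1)) (x : Site (d + 1)) :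
    Summable fun i => slotPsiS r n (F i) α x := by
  classical
  simp only [slotPsiS_eq_add_mul_sum_sigma]
  exact (hF α x).add ((summable_sum fun s _ => (hF _ _).mul_left _).mul_left _)

section Entry

include hn hr

/-- [folklore] **THE TRANSPORTED ff ENTRY AS THREE NESTED SCALAR SLOT TRANSPORTS**: for every table family `S`, slot `(ν, u)`, legs `(v, q)`, directions `κ′ β`,
`(Ψ̂ᵀ ∘ slotPsiS S ν u ∘ Ψ̂) v q (inl κ′)(inl β) = slotPsiS_{(β,q)}[κ₂ w ↦ slotPsiS_{(κ′,v)}[κ₁ y ↦ slotPsiS_{(ν,u)}[κ t ↦ S κ t y w (inl κ₁)(inl κ₂)]]]`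
(right leg = slot transport of the row family, left leg = slot transport of the column family — d1-leaf-03 TT3b; all sums finite). -/
theorem transport_entry_eq (S : Fin (d + 1) → Site (d + 1) → MKer (d + 1) (Fib d)) (ν : Fin (d + 1)) (u v q : Site (d + 1)) (κ' β : Fin (d + 1)) :
    comp (comp (trK (psiKS r n)) (slotPsiS r n S ν u)) (psiKS r n) v q (Sum.inl κ') (Sum.inl β)
      = slotPsiS r n (fun κ₂ w => slotPsiS r n (fun κ₁ y => slotPsiS r n (fun κ t => S κ t y w (Sum.inl κ₁) (Sum.inl κ₂)) ν u) κ' v) β q := by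
  rw [comp_psiKS_inl_right hn hr (comp (trK (psiKS r n)) (slotPsiS r n S ν u)) v q (Sum.inl κ') β]
  congr 1
  funext κ₂ w
  rw [comp_trK_psiKS_inl_left hn hr (slotPsiS r n S ν u) v w κ' (Sum.inl κ₂)]
  congr 1
  funext κ₁ y
  exact slotPsiS_apply_kernel r n S ν u y w (Sum.inl κ₁) (Sum.inl κ₂)

end Entry

/-! ## §2 The class current of `𝒯S` is the slot transport of the reweighted class current of `S` -/

section Current

variable {S : Fin (d + 1) → Site (d + 1) → MKer (d + 1) (Fib d)} {Cs δs : ℝ}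

include hn hr

/-- NOT IN PRINT; OUR BOOKKEEPING ([folklore]; STEP A — THE SLOT).  For a local `S`, a bounded weight `σ` with slot-transport reweighting `σ′` (hypothesis `hσ′`: for every scalar
family with summable components `Σ'_u σ u·slotPsiS T ν u = Σ'_u σ′ u·T ν u`), and all `v q κ′ β`:
`Σ'_u σ u·(𝒯S) ν u v q (inl κ′)(inl β) = slotPsiS_{(β,q)}[κ₂ w ↦ slotPsiS_{(κ′,v)}[κ₁ y ↦ Σ'_u σ′ u·S ν u y w (inl κ₁)(inl κ₂)]]`. -/
theorem tsum_slot_transport_eq (hS : LocStencil S Cs δs) (hδs : 0 < δs) {σ σ' : Site (d + 1) → ℝ} {Bσ : ℝ} (hσ : ∀ u, |σ u| ≤ Bσ) (ν : Fin (d + 1))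
    (hσ' : ∀ T : Form1 (d + 1) ℝ, (∀ κ, Summable (T κ)) → ∑' u, σ u * slotPsiS r n T ν u = ∑' u, σ' u * T ν u)
    (v q : Site (d + 1)) (κ' β : Fin (d + 1)) :
    ∑' u, σ u * comp (comp (trK (psiKS r n)) (slotPsiS r n S ν u)) (psiKS r n) v q (Sum.inl κ') (Sum.inl β)
      = slotPsiS r n (fun κ₂ w => slotPsiS r n (fun κ₁ y => ∑' u, σ' u * S ν u y w (Sum.inl κ₁) (Sum.inl κ₂)) κ' v) β q := by
  -- the slot families `κ t ↦ S κ t y w κ₁ κ₂` have summable components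
  have hT : ∀ (y w : Site (d + 1)) (κ₁ κ₂ κ : Fin (d + 1)), Summable fun t : Site (d + 1) => S κ t y w (Sum.inl κ₁) (Sum.inl κ₂) := by
    intro y w κ₁ κ₂ κ
    have h := summable_slot_locStencil hS hδs (s := fun _ => (1 : ℝ)) (Bs := 1) (fun _ => by rw [abs_one]) κ y w (Sum.inl κ₁) (Sum.inl κ₂)
    simpa only [one_mul] using h
  -- the innermost transport: summable in `u` against `σ`
  have h0 : ∀ (y w : Site (d + 1)) (κ₁ κ₂ : Fin (d + 1)), Summable fun u : Site (d + 1) =>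
      σ u * slotPsiS r n (fun κ t => S κ t y w (Sum.inl κ₁) (Sum.inl κ₂)) ν u := fun y w κ₁ κ₂ =>
    summable_weight_mul hσ (summable_slotPsiS hn r (hT y w κ₁ κ₂) ν)
  -- the middle transport: summable in `u`
  have h1 : ∀ (w : Site (d + 1)) (κ₂ : Fin (d + 1)), Summable fun u : Site (d + 1) =>
      σ u * slotPsiS r n (fun κ₁ y => slotPsiS r n (fun κ t => S κ t y w (Sum.inl κ₁) (Sum.inl κ₂)) ν u) κ' v := by
    intro w κ₂
    have h := summable_slotPsiS_param (r := r) (n := n)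
      (F := fun u => fun κ₁ y => σ u * slotPsiS r n (fun κ t => S κ t y w (Sum.inl κ₁) (Sum.inl κ₂)) ν u) (fun κ₁ y => h0 y w κ₁ κ₂) κ' v
    refine h.congr fun u => ?_
    rw [← mul_slotPsiS]
  rw [tsum_congr fun u => by rw [transport_entry_eq hn hr S ν u v q κ' β, mul_slotPsiS, ]]
  rw [tsum_slotPsiS_param r (F := fun u => fun κ₂ w => σ u * slotPsiS r n (fun κ₁ y => slotPsiS r n (fun κ t => S κ t y w (Sum.inl κ₁) (Sum.inl κ₂)) ν u) κ' v)
    (fun κ₂ w => h1 w κ₂) β q]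
  congr 1
  funext κ₂ w
  rw [tsum_congr fun u => by rw [mul_slotPsiS]]
  rw [tsum_slotPsiS_param r (F := fun u => fun κ₁ y => σ u * slotPsiS r n (fun κ t => S κ t y w (Sum.inl κ₁) (Sum.inl κ₂)) ν u) (fun κ₁ y => h0 y w κ₁ κ₂) κ' v]
  congr 1
  funext κ₁ y
  exact hσ' (fun κ t => S κ t y w (Sum.inl κ₁) (Sum.inl κ₂)) (hT y w κ₁ κ₂)

/-- NOT IN PRINT; OUR BOOKKEEPING ([folklore]; STEPS B–C — THE LEGS).  **THE CLASS CURRENT OF THE TRANSPORTED FAMILY IS THE SLOT TRANSPORT OF THE REWEIGHTED CLASS CURRENT**: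
for a local `S`, bounded weights `ρ σ` with slot-transport reweightings `ρ′` (direction `β`) and `σ′` (direction `ν`, bounded), and all `κ′ v`:
`Σ'_q ρ q·Σ'_u σ u·(𝒯S) ν u v q (inl κ′)(inl β) = slotPsiS r n (κ₁ y ↦ Σ'_q ρ′ q·Σ'_u σ′ u·S ν u y q (inl κ₁)(inl β)) κ′ v`. -/
theorem current_transport_eq_slotPsiS (hS : LocStencil S Cs δs) (hδs : 0 < δs) {ρ ρ' σ σ' : Site (d + 1) → ℝ} {Bρ' Bσ Bσ' : ℝ}
    (hρ'b : ∀ q, |ρ' q| ≤ Bρ') (hσ : ∀ u, |σ u| ≤ Bσ) (hσ'b : ∀ u, |σ' u| ≤ Bσ') (ν β : Fin (d + 1))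
    (hσ' : ∀ T : Form1 (d + 1) ℝ, (∀ κ, Summable (T κ)) → ∑' u, σ u * slotPsiS r n T ν u = ∑' u, σ' u * T ν u)
    (hρ' : ∀ T : Form1 (d + 1) ℝ, (∀ κ, Summable (T κ)) → ∑' q, ρ q * slotPsiS r n T β q = ∑' q, ρ' q * T β q)
    (κ' : Fin (d + 1)) (v : Site (d + 1)) :
    ∑' q, ρ q * ∑' u, σ u * comp (comp (trK (psiKS r n)) (slotPsiS r n S ν u)) (psiKS r n) v q (Sum.inl κ') (Sum.inl β)
      = slotPsiS r n (fun κ₁ y => ∑' q, ρ' q * ∑' u, σ' u * S ν u y q (Sum.inl κ₁) (Sum.inl β)) κ' v := by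
  -- Step A under the `q`-sum
  rw [tsum_congr fun q => by rw [tsum_slot_transport_eq hn hr hS hδs hσ ν hσ' v q κ' β]]
  -- the row families `κ₂ w ↦ slotPsiS_{(κ′,v)}[κ₁ y ↦ K y w κ₁ κ₂]` have summable components (`K` = the reweighted slot sum)
  have hK : ∀ (y : Site (d + 1)) (κ₁ κ₂ : Fin (d + 1)), Summable fun w : Site (d + 1) => ∑' u, σ' u * S ν u y w (Sum.inl κ₁) (Sum.inl κ₂) := by
    intro y κ₁ κ₂
    have h := summable_leg_slot_locStencil hS hδs (h := fun _ => (1 : ℝ)) (Bh := 1) (fun _ => by rw [abs_one]) hσ'b ν y (Sum.inl κ₁) (Sum.inl κ₂)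
    simpa only [one_mul] using h
  have hH : ∀ κ₂ : Fin (d + 1), Summable fun w : Site (d + 1) =>
      slotPsiS r n (fun κ₁ y => ∑' u, σ' u * S ν u y w (Sum.inl κ₁) (Sum.inl κ₂)) κ' v := fun κ₂ =>
    summable_slotPsiS_param (r := r) (n := n) (F := fun w => fun κ₁ y => ∑' u, σ' u * S ν u y w (Sum.inl κ₁) (Sum.inl κ₂)) (fun κ₁ y => hK y κ₁ κ₂) κ' v
  -- Step B: the leg weight through the outer transport
  rw [hρ' (fun κ₂ w => slotPsiS r n (fun κ₁ y => ∑' u, σ' u * S ν u y w (Sum.inl κ₁) (Sum.inl κ₂)) κ' v) hH]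
  -- Step C: the `q`-sum back inside the middle transport
  have h2 : ∀ (κ₁ : Fin (d + 1)) (y : Site (d + 1)), Summable fun q : Site (d + 1) => ρ' q * ∑' u, σ' u * S ν u y q (Sum.inl κ₁) (Sum.inl β) :=
    fun κ₁ y => summable_leg_slot_locStencil hS hδs hρ'b hσ'b ν y (Sum.inl κ₁) (Sum.inl β)
  rw [tsum_congr fun q => by rw [mul_slotPsiS]]
  exact tsum_slotPsiS_param r (F := fun q => fun κ₁ y => ρ' q * ∑' u, σ' u * S ν u y q (Sum.inl κ₁) (Sum.inl β)) h2 κ' v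

end Current

/-! ## §3 T-INV: the (D)-class passes from `S` to `𝒯S` -/

section TInv

variable {S : Fin (d + 1) → Site (d + 1) → MKer (d + 1) (Fib d)} {Cs δs : ℝ}

include hn hr

/-- NOT IN PRINT; OUR BOOKKEEPING ([folklore]; **T-INV**).  For `0 < n`, `r ∈ box (d+1) n`, ANY local stencil family `S`, slot direction `ν`, leg direction `β`: IF every class-weighted
two-leg current of `S` — `I(κ′,v) = Σ'_q (c₁ + dΨ₁(q_β))·Σ'_u (c₂ + dΨ₂(u_ν))·S ν u v q (inl κ′)(inl β)`, all `c₁ c₂`, all bounded `Ψ₁ Ψ₂` — is first-leg divergence-free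
(`Σ_κ′ (I(κ′,v) − I(κ′,v − e_κ′)) = 0`, the hypothesis `hyp` of leaf-04's `ExitFaceCurrentTowerStep.divFree_e3OfK_of_divFree`), THEN the same holds for the transported family
`𝒯S = κ u ↦ Ψ̂_Sᵀ ∘ slotPsiS r n S κ u ∘ Ψ̂_S`, VERBATIM shape.  (The transported current is `slotPsiS` of the reweighted current of `S` — §2 with `ClassWeightSlotTransport` — and a
divergence-free bond family is fixed by `slotPsiS` — TT7.) -/
theorem divFree_transport_of_divFree (hS : LocStencil S Cs δs) (hδs : 0 < δs) (ν β : Fin (d + 1))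
    (hyp : ∀ (c₁ : ℝ) (Ψ₁ : ℤ → ℝ) (B₁ : ℝ), (∀ s, |Ψ₁ s| ≤ B₁) → ∀ (c₂ : ℝ) (Ψ₂ : ℤ → ℝ) (B₂ : ℝ), (∀ s, |Ψ₂ s| ≤ B₂) → ∀ v : Site (d + 1),
      ∑ κ' : Fin (d + 1),
        ((∑' q : Site (d + 1), (c₁ + (Ψ₁ (q β + 1) - Ψ₁ (q β))) * ∑' u : Site (d + 1), (c₂ + (Ψ₂ (u ν + 1) - Ψ₂ (u ν))) * S ν u v q (Sum.inl κ') (Sum.inl β))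
          - ∑' q : Site (d + 1), (c₁ + (Ψ₁ (q β + 1) - Ψ₁ (q β))) * ∑' u : Site (d + 1), (c₂ + (Ψ₂ (u ν + 1) - Ψ₂ (u ν))) *
              S ν u (v - B6BondElimination.unitVec κ') q (Sum.inl κ') (Sum.inl β)) = 0)
    (c₁ : ℝ) (Ψ₁ : ℤ → ℝ) (B₁ : ℝ) (hΨ₁ : ∀ s, |Ψ₁ s| ≤ B₁) (c₂ : ℝ) (Ψ₂ : ℤ → ℝ) (B₂ : ℝ) (hΨ₂ : ∀ s, |Ψ₂ s| ≤ B₂) (v : Site (d + 1)) :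
    ∑ κ' : Fin (d + 1),
      ((∑' q : Site (d + 1), (c₁ + (Ψ₁ (q β + 1) - Ψ₁ (q β))) * ∑' u : Site (d + 1), (c₂ + (Ψ₂ (u ν + 1) - Ψ₂ (u ν))) *
            comp (comp (trK (psiKS r n)) (slotPsiS r n S ν u)) (psiKS r n) v q (Sum.inl κ') (Sum.inl β))
        - ∑' q : Site (d + 1), (c₁ + (Ψ₁ (q β + 1) - Ψ₁ (q β))) * ∑' u : Site (d + 1), (c₂ + (Ψ₂ (u ν + 1) - Ψ₂ (u ν))) *
            comp (comp (trK (psiKS r n)) (slotPsiS r n S ν u)) (psiKS r n) (v - B6BondElimination.unitVec κ') q (Sum.inl κ') (Sum.inl β)) = 0 := by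
  -- the reweighted potentials (ONE for all families): slot direction `ν`, leg direction `β`
  obtain ⟨Ψ₂', hΨ₂'b, hσ'⟩ := exists_classPot_slotPsiS hn r c₂ Ψ₂ hΨ₂ ν
  obtain ⟨Ψ₁', hΨ₁'b, hρ'⟩ := exists_classPot_slotPsiS hn r c₁ Ψ₁ hΨ₁ β
  have hσ : ∀ u : Site (d + 1), |c₂ + (Ψ₂ (u ν + 1) - Ψ₂ (u ν))| ≤ |c₂| + (B₂ + B₂) := fun u =>
    (abs_add_le _ _).trans (add_le_add le_rfl ((abs_sub _ _).trans (add_le_add (hΨ₂ _) (hΨ₂ _))))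
  have hσ'b : ∀ u : Site (d + 1), |c₂ + (Ψ₂' (u ν + 1) - Ψ₂' (u ν))|
      ≤ |c₂| + ((B₂ + (|c₂| + (B₂ + B₂)) * faceWtSum r n) + (B₂ + (|c₂| + (B₂ + B₂)) * faceWtSum r n)) := fun u =>
    (abs_add_le _ _).trans (add_le_add le_rfl ((abs_sub _ _).trans (add_le_add (hΨ₂'b _) (hΨ₂'b _))))
  have hρ'b : ∀ q : Site (d + 1), |c₁ + (Ψ₁' (q β + 1) - Ψ₁' (q β))|
      ≤ |c₁| + ((B₁ + (|c₁| + (B₁ + B₁)) * faceWtSum r n) + (B₁ + (|c₁| + (B₁ + B₁)) * faceWtSum r n)) := fun q =>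
    (abs_add_le _ _).trans (add_le_add le_rfl ((abs_sub _ _).trans (add_le_add (hΨ₁'b _) (hΨ₁'b _))))
  -- the transported current IS the slot transport of the reweighted current …
  have key : ∀ (κ' : Fin (d + 1)) (y : Site (d + 1)),
      ∑' q : Site (d + 1), (c₁ + (Ψ₁ (q β + 1) - Ψ₁ (q β))) * ∑' u : Site (d + 1), (c₂ + (Ψ₂ (u ν + 1) - Ψ₂ (u ν))) *
          comp (comp (trK (psiKS r n)) (slotPsiS r n S ν u)) (psiKS r n) y q (Sum.inl κ') (Sum.inl β)
        = slotPsiS r n (fun κ₁ y => ∑' q : Site (d + 1), (c₁ + (Ψ₁' (q β + 1) - Ψ₁' (q β))) * ∑' u : Site (d + 1), (c₂ + (Ψ₂' (u ν + 1) - Ψ₂' (u ν))) *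
            S ν u y q (Sum.inl κ₁) (Sum.inl β)) κ' y := fun κ' y =>
    current_transport_eq_slotPsiS hn hr hS hδs (ρ := fun q => c₁ + (Ψ₁ (q β + 1) - Ψ₁ (q β))) (ρ' := fun q => c₁ + (Ψ₁' (q β + 1) - Ψ₁' (q β)))
      (σ := fun u => c₂ + (Ψ₂ (u ν + 1) - Ψ₂ (u ν))) (σ' := fun u => c₂ + (Ψ₂' (u ν + 1) - Ψ₂' (u ν))) hρ'b hσ hσ'b ν β hσ' hρ' κ' y
  -- … which is first-leg divergence-free by `hyp` with the reweighted data, hence FIXED by `slotPsiS` (TT7)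
  have hdiv := hyp c₁ Ψ₁' _ hΨ₁'b c₂ Ψ₂' _ hΨ₂'b
  have hdiv' : ∀ x : Site (d + 1), ∑ κ : Fin (d + 1),
      ((∑' q : Site (d + 1), (c₁ + (Ψ₁' (q β + 1) - Ψ₁' (q β))) * ∑' u : Site (d + 1), (c₂ + (Ψ₂' (u ν + 1) - Ψ₂' (u ν))) *
            S ν u (x - unitVec κ) q (Sum.inl κ) (Sum.inl β))
        - ∑' q : Site (d + 1), (c₁ + (Ψ₁' (q β + 1) - Ψ₁' (q β))) * ∑' u : Site (d + 1), (c₂ + (Ψ₂' (u ν + 1) - Ψ₂' (u ν))) *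
            S ν u x q (Sum.inl κ) (Sum.inl β)) = 0 := by
    intro x
    have h := hdiv x
    rw [← neg_eq_zero, ← Finset.sum_neg_distrib]
    simpa only [neg_sub, b6unitVec_eq] using h
  have hfix := slotPsiS_eq_self_of_div_eq_zero hn r
    (T := fun κ₁ y => ∑' q : Site (d + 1), (c₁ + (Ψ₁' (q β + 1) - Ψ₁' (q β))) * ∑' u : Site (d + 1), (c₂ + (Ψ₂' (u ν + 1) - Ψ₂' (u ν))) *
      S ν u y q (Sum.inl κ₁) (Sum.inl β)) hdiv'
  have key' : ∀ (κ' : Fin (d + 1)) (y : Site (d + 1)),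
      ∑' q : Site (d + 1), (c₁ + (Ψ₁ (q β + 1) - Ψ₁ (q β))) * ∑' u : Site (d + 1), (c₂ + (Ψ₂ (u ν + 1) - Ψ₂ (u ν))) *
          comp (comp (trK (psiKS r n)) (slotPsiS r n S ν u)) (psiKS r n) y q (Sum.inl κ') (Sum.inl β)
        = ∑' q : Site (d + 1), (c₁ + (Ψ₁' (q β + 1) - Ψ₁' (q β))) * ∑' u : Site (d + 1), (c₂ + (Ψ₂' (u ν + 1) - Ψ₂' (u ν))) *
            S ν u y q (Sum.inl κ') (Sum.inl β) := fun κ' y => by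
    rw [key κ' y, hfix]
  simp only [key']
  exact hdiv v

end TInv

end Summit.QuantumFields.BalabanUV.Beta.GAN24.TransportedDivFree

end
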